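import Mathlib.MeasureTheory.Measure.Lebesgue.VolumeOfBalls
import Mathlib.MeasureTheory.Integral.IntervalIntegral.Basic
import Summits.NavierStokesRegularity.NavierStokesRegularity.Theorems.SelfMixingDichotomyMixingPayoffMassExportTools
import Literature.Analysis.FluidPDE.SuitableWeak
import HarnessLib

/-!
# Crux `SelfMixingDichotomy.CoherentScaleExclusion` (stmt-NavierStokesRegularity-1423), line
  `registered`: tools for the LOAD FLOOR `stub_loadFloor`

Helper file (theorems only; lands `--supports stmt-NavierStokesRegularity-1423`, anchor
`lfaux_loadOfCknC`) for the registered helper stub `stub_loadFloor` (LF, "at bounded local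
Reynolds number nothing `δ`-mixes") of the lead's skeleton
`Cruxes/CoherentScaleExclusion/Lines/birth.lean`, proved in
`SelfMixingDichotomyCoherentScaleExclusionLoadFloor.lean` (a bump-launched scalar tested against a
cutoff of `B(x₀, A r)`; the mass export is controlled by the scaled load `cknC (A r)`). Contents:

* `LoadFloor.mul_le_young3`, `LoadFloor.mul_le_young2` — root-free Young inequalities
  `θ v ≤ k³ (θ + θ²) + k'³ v³` (`3k²k' = 1`) and `θ ψ ≤ (L/2) θ² + ψ²/(2L)`;
* `LoadFloor.intervalIntegral_setIntegral_norm_pow_three_le` and the anchor `lfaux_loadOfCknC` —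
  **the load controls the local space–time `L³` integral**:
  `∫_{t₀}^{t₁} ∫_{B(x₀, ρ)} ‖u‖³ ≤ ρ² M` whenever `C(ρ) ≤ M` at `(T, x₀)` and
  `[t₀, t₁] ⊆ (T − ρ², T)` (Tonelli on the parabolic cylinder, Mathlib `setLIntegral_prod`);
* `LoadFloor.continuousOn_integral_production`, `LoadFloor.continuousOn_setIntegral_norm_pow_three`
  — time continuity of `s ↦ ∫ θ(s) (Δψ + Dψ[u(s)])` and of `s ↦ ∫_{B} ‖u(s)‖³` for jointly smooth
  bounded drifts (dominated convergence), so that the production can be integrated in time (FTC);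
* `LoadFloor.production_lower_bound` — pointwise in time,
  `∫ θ (Δψ + Dψ[v]) ≥ −(C₂/R²) ∫ θ − (C₁/R)(k³(∫ θ + ∫ θ²) + k'³ ∫_{B(x₀, 2R)} ‖v‖³)` for `θ ≥ 0`
  and a cutoff with `|Δψ| ≤ C₂/R²`, `‖Dψ‖ ≤ C₁/R`, `Dψ = 0` off `B(x₀, 2R)`;
* `LoadFloor.integral_mul_cutoff_le` — `∫ θ ψ ≤ (L/2) ∫ θ² + ρ³ |B₁|/(2L)` for `0 ≤ ψ ≤ 1`
  vanishing off `B(x₀, ρ)`;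
* `LoadFloor.bump_integral_ge`, `LoadFloor.bump_integral_sq_le`,
  `LoadFloor.bump_mul_cutoff_integral` — masses of a `ContDiffBump` datum: `rIn³ |B₁| ≤ ∫ φ`,
  `∫ φ² ≤ ∫ φ`, `∫ φ ψ = ∫ φ` when `ψ = 1` on `B̄(c, R) ⊇ supp φ`.

Everything is proved (standard axioms); no definitions, no named facts. References:
L. Caffarelli, R. Kohn, L. Nirenberg, CPAM 35 (1982), §2 (the scaled quantity `C(r)`);
A. J. Majda, A. L. Bertozzi, *Vorticity and Incompressible Flow* (CUP 2002), §3.1.1.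
-/

noncomputable section

open MeasureTheory Set Function Metric Filter Topology
open scoped ContDiff InnerProductSpace Laplacian ENNReal

-- `Summit = Problem` for this summit; the tree lakefile sets `weak.linter.dupNamespace = false`.
set_option linter.dupNamespace false

namespace Summit.NavierStokesRegularity.NavierStokesRegularity.Theorems

open Literature.Analysis.FluidPDE

namespace LoadFloor

/-- **Young's inequality `θ v ≤ k³ (θ + θ²) + k'³ v³`** for `θ, v, k, k' ≥ 0` with
`3 k² k' = 1`: with `s = √θ`, `θ + θ² ≥ 2 s³` and `2 (k s)³ + (k' v)³ ≥ 3 (k s)² (k' v) = θ v`. -/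
theorem mul_le_young3 {θ v k k' : ℝ} (hθ : 0 ≤ θ) (hv : 0 ≤ v) (hk : 0 ≤ k) (hk' : 0 ≤ k')
    (h : 3 * k ^ 2 * k' = 1) : θ * v ≤ k ^ 3 * (θ + θ ^ 2) + k' ^ 3 * v ^ 3 := by
  obtain ⟨s, hs, rfl⟩ : ∃ s, 0 ≤ s ∧ θ = s ^ 2 :=
    ⟨Real.sqrt θ, Real.sqrt_nonneg _, (Real.sq_sqrt hθ).symm⟩
  have ha : 0 ≤ k * s := mul_nonneg hk hs
  have hc : 0 ≤ k' * v := mul_nonneg hk' hv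
  have h1 : s ^ 2 * v = 3 * (k * s) ^ 2 * (k' * v) := by
    linear_combination -(s ^ 2 * v) * h
  have h2 : 3 * (k * s) ^ 2 * (k' * v) ≤ 2 * (k * s) ^ 3 + (k' * v) ^ 3 := by
    nlinarith [mul_nonneg (mul_nonneg (sq_nonneg (k * s - k' * v)) ha) zero_le_two,
      mul_nonneg (sq_nonneg (k * s - k' * v)) hc]
  have h3 : 2 * (k * s) ^ 3 ≤ k ^ 3 * (s ^ 2 + (s ^ 2) ^ 2) := by
    have : 0 ≤ k ^ 3 * (s ^ 2 * (s - 1) ^ 2) := mul_nonneg (pow_nonneg hk 3) (by positivity)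
    nlinarith [this]
  linarith

/-- Young with two factors: `θ ψ ≤ (L/2) θ² + ψ²/(2L)` for `L > 0`. -/
theorem mul_le_young2 (θ ψ : ℝ) {L : ℝ} (hL : 0 < L) :
    θ * ψ ≤ L / 2 * θ ^ 2 + 1 / (2 * L) * ψ ^ 2 := by
  have h : 0 ≤ (L * θ - ψ) ^ 2 / (2 * L) := by positivity
  have e : (L * θ - ψ) ^ 2 / (2 * L) = L / 2 * θ ^ 2 + 1 / (2 * L) * ψ ^ 2 - θ * ψ := by
    field_simp
    ring
  linarith

/-! ### The load controls the time-integrated local `L³` norm of the drift -/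

/-- **The scaled load bounds the local space–time `L³` integral of the drift.** If `u` is
continuous on `[0, T) × ℝ³`, `0 < ρ`, `0 ≤ T − ρ²`, `[t₀, t₁] ⊆ (T − ρ², T)` and
`C(ρ) = ρ⁻² ∬_{Q_ρ(T, x₀)} |u|³ ≤ M` (`cknC`), then
`∫_{t₀}^{t₁} ∫_{B(x₀, ρ)} ‖u‖³ ≤ ρ² M` (Tonelli on the cylinder `(T − ρ², T) × B(x₀, ρ)`). -/
theorem intervalIntegral_setIntegral_norm_pow_three_le
    {u : ℝ → EuclideanSpace ℝ (Fin 3) → EuclideanSpace ℝ (Fin 3)} {T ρ M t₀ t₁ : ℝ}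
    {x₀ : EuclideanSpace ℝ (Fin 3)} (hρ : 0 < ρ) (hM : 0 ≤ M)
    (hcont : ContinuousOn (Function.uncurry u) (Set.Ico 0 T ×ˢ Set.univ))
    (h0 : 0 ≤ T - ρ ^ 2) (ht₀ : T - ρ ^ 2 < t₀) (ht₀₁ : t₀ ≤ t₁) (ht₁ : t₁ < T)
    (hC : cknC ρ ((T, x₀) : ℝ × (EuclideanSpace ℝ (Fin 3))) u ≤ ENNReal.ofReal M) :
    ∫ s in t₀..t₁, ∫ x in Metric.ball x₀ ρ, ‖u s x‖ ^ 3 ≤ ρ ^ 2 * M := by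
  set B : Set (EuclideanSpace ℝ (Fin 3)) := Metric.ball x₀ ρ with hB
  set I : Set ℝ := Set.Ioo (T - ρ ^ 2) T with hI
  -- the cylinder integral is at most `ρ² M`
  have hcyl : parabolicCylinder ρ ((T, x₀) : ℝ × (EuclideanSpace ℝ (Fin 3))) = I ×ˢ B := by
    simp only [parabolicCylinder, hI, hB]
  have hL : ∫⁻ q in I ×ˢ B, ‖u q.1 q.2‖ₑ ^ (3 : ℕ) ≤ ENNReal.ofReal (ρ ^ 2 * M) := by
    have hne : ENNReal.ofReal ρ ^ 2 ≠ 0 := pow_ne_zero _ (ENNReal.ofReal_pos.2 hρ).ne'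
    have hne' : ENNReal.ofReal ρ ^ 2 ≠ (⊤ : ℝ≥0∞) := ENNReal.pow_ne_top ENNReal.ofReal_ne_top
    unfold cknC at hC
    rw [hcyl] at hC
    rw [ENNReal.ofReal_mul (sq_nonneg _), ENNReal.ofReal_pow hρ.le]
    calc ∫⁻ q in I ×ˢ B, ‖u q.1 q.2‖ₑ ^ (3 : ℕ)
        = ENNReal.ofReal ρ ^ 2 *
            ((ENNReal.ofReal ρ ^ 2)⁻¹ * ∫⁻ q in I ×ˢ B, ‖u q.1 q.2‖ₑ ^ (3 : ℕ)) := by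
          rw [← mul_assoc, ENNReal.mul_inv_cancel hne hne', one_mul]
      _ ≤ ENNReal.ofReal ρ ^ 2 * ENNReal.ofReal M := by gcongr
  -- Tonelli on the cylinder
  have hsub : I ×ˢ B ⊆ Set.Ico 0 T ×ˢ (Set.univ : Set (EuclideanSpace ℝ (Fin 3))) :=
    prod_mono (fun s hs => ⟨h0.trans hs.1.le, hs.2⟩) (subset_univ _)
  have hmeas : AEMeasurable (fun q : ℝ × (EuclideanSpace ℝ (Fin 3)) => ‖u q.1 q.2‖ₑ ^ (3 : ℕ))
      (((volume : Measure ℝ).prod (volume : Measure (EuclideanSpace ℝ (Fin 3)))).restrict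
        (I ×ˢ B)) := by
    have hc : ContinuousOn (fun q : ℝ × EuclideanSpace ℝ (Fin 3) => ‖u q.1 q.2‖ₑ ^ (3 : ℕ))
        (I ×ˢ B) :=
      ((ENNReal.continuous_pow 3).comp continuous_enorm).comp_continuousOn (hcont.mono hsub)
    exact hc.aemeasurable (measurableSet_Ioo.prod measurableSet_ball)
  have hTon : ∫⁻ q in I ×ˢ B, ‖u q.1 q.2‖ₑ ^ (3 : ℕ) =
      ∫⁻ s in I, ∫⁻ x in B, ‖u s x‖ₑ ^ (3 : ℕ) := by
    rw [Measure.volume_eq_prod, setLIntegral_prod _ hmeas]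
  -- `ofReal (∫ f) ≤ ∫⁻ ofReal f` for pointwise nonnegative `f` (no integrability needed)
  have key : ∀ {α : Type} [MeasurableSpace α] (μ : Measure α) (f : α → ℝ), (∀ a, 0 ≤ f a) →
      ENNReal.ofReal (∫ a, f a ∂μ) ≤ ∫⁻ a, ENNReal.ofReal (f a) ∂μ := fun μ f hf =>
    (Real.ofReal_le_enorm _).trans ((enorm_integral_le_lintegral_enorm _).trans_eq
      (lintegral_congr fun a => Real.enorm_eq_ofReal (hf a)))
  -- the chain
  have hJ : ENNReal.ofReal (∫ s in t₀..t₁, ∫ x in B, ‖u s x‖ ^ 3) ≤ ENNReal.ofReal (ρ ^ 2 * M) := by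
    rw [intervalIntegral.integral_of_le ht₀₁]
    calc ENNReal.ofReal (∫ s in Ioc t₀ t₁, ∫ x in B, ‖u s x‖ ^ 3)
        ≤ ∫⁻ s in Ioc t₀ t₁, ENNReal.ofReal (∫ x in B, ‖u s x‖ ^ 3) :=
          key _ _ fun s => integral_nonneg fun x => pow_nonneg (norm_nonneg _) 3
      _ ≤ ∫⁻ s in Ioc t₀ t₁, ∫⁻ x in B, ‖u s x‖ₑ ^ (3 : ℕ) := by
          refine lintegral_mono fun s => ?_
          refine (key _ _ fun x => pow_nonneg (norm_nonneg _) 3).trans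
            (le_of_eq (lintegral_congr fun x => ?_))
          rw [← ofReal_norm, ENNReal.ofReal_pow (norm_nonneg _)]
      _ ≤ ∫⁻ s in I, ∫⁻ x in B, ‖u s x‖ₑ ^ (3 : ℕ) :=
          lintegral_mono_set fun s hs => ⟨ht₀.trans hs.1, hs.2.trans_lt ht₁⟩
      _ = ∫⁻ q in I ×ˢ B, ‖u q.1 q.2‖ₑ ^ (3 : ℕ) := hTon.symm
      _ ≤ ENNReal.ofReal (ρ ^ 2 * M) := hL
  exact (ENNReal.ofReal_le_ofReal_iff (by positivity)).1 hJ

/-- **Continuity of the production `s ↦ ∫ θ(s) (Δψ + Dψ[u(s)])`** on `[a, b]` for `θ` jointly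
smooth with uniform rapid decay, `u` jointly smooth and bounded on `[a, b] × ℝ³`, and a `C²`
weight `ψ` with `ψ, Dψ, D²ψ` bounded (dominated convergence: the integrand is continuous in `s`
for every `x` and dominated by a multiple of `(1 + ‖x‖)^{-4}`). -/
theorem continuousOn_integral_production {a b : ℝ} (hab : a < b)
    {θ : ℝ → EuclideanSpace ℝ (Fin 3) → ℝ}
    {u : ℝ → EuclideanSpace ℝ (Fin 3) → EuclideanSpace ℝ (Fin 3)}
    {ψ : EuclideanSpace ℝ (Fin 3) → ℝ} {Mu Mw : ℝ}
    (hsm : IsSmoothSpaceTimeOn (Icc a b) θ) (hd : HasUniformRapidDecayOn (Icc a b) θ)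
    (husm : IsSmoothSpaceTimeOn (Icc a b) u) (hub : ∀ t ∈ Icc a b, ∀ x, ‖u t x‖ ≤ Mu)
    (hw : ContDiff ℝ 2 ψ) (hw1 : ∀ x, ‖fderiv ℝ ψ x‖ ≤ Mw)
    (hw2 : ∀ x, ‖fderiv ℝ (fderiv ℝ ψ) x‖ ≤ Mw) :
    ContinuousOn (fun s => ∫ x, θ s x * ((Δ ψ) x + fderiv ℝ ψ x (u s x))) (Icc a b) := by
  set S : Set ℝ := Icc a b with hS_def
  have haS : a ∈ S := ⟨le_rfl, hab.le⟩
  have hr : (Module.finrank ℝ (EuclideanSpace ℝ (Fin 3)) : ℝ) < 4 := by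
    rw [finrank_euclideanSpace_fin]; norm_num
  obtain ⟨C, hC, hCb⟩ := hd.norm_le_rpow 4
  have e4 : ((4 : ℕ) : ℝ) = 4 := by norm_num
  rw [e4] at hCb
  have hθc : ∀ s ∈ S, Continuous (θ s) := fun s hs => hsm.continuous_slice hs
  have huc : ∀ s ∈ S, Continuous (u s) := fun s hs => husm.continuous_slice hs
  have hDwc : Continuous (fderiv ℝ ψ) := hw.continuous_fderiv two_ne_zero
  have hΔwc : Continuous (Δ ψ) := continuous_laplacian hw
  have hMu : 0 ≤ Mu := (norm_nonneg _).trans (hub a haS 0)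
  have hMw : 0 ≤ Mw := (norm_nonneg _).trans (hw1 0)
  have hΔwb : ∀ x, ‖(Δ ψ) x‖ ≤ 3 * Mw := fun x => by
    have := norm_laplacian_le ψ x
    rw [finrank_euclideanSpace_fin] at this
    push_cast at this
    exact this.trans (by gcongr; exact hw2 x)
  have hweight : Integrable (fun x : EuclideanSpace ℝ (Fin 3) => (1 + ‖x‖) ^ (-(4 : ℝ)))
      (volume : Measure (EuclideanSpace ℝ (Fin 3))) :=
    integrable_one_add_norm hr
  refine continuousOn_of_dominated
    (bound := fun x => (3 * Mw + Mw * Mu) * (C * (1 + ‖x‖) ^ (-(4 : ℝ))))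
    (fun s hs => ((hθc s hs).mul (hΔwc.add (hDwc.clm_apply (huc s hs)))).aestronglyMeasurable)
    (fun s hs => Eventually.of_forall fun x => ?_) ((hweight.const_mul C).const_mul _)
    (Eventually.of_forall fun x => ?_)
  · rw [norm_mul, mul_comm]
    refine mul_le_mul ?_ (hCb s hs x) (norm_nonneg _) (by positivity)
    refine (norm_add_le _ _).trans (add_le_add (hΔwb x) ?_)
    exact (ContinuousLinearMap.le_opNorm _ _).trans
      (mul_le_mul (hw1 x) (hub s hs x) (norm_nonneg _) hMw)
  · exact (hsm.continuousOn_time x).mul (continuousOn_const.add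
      ((fderiv ℝ ψ x).continuous.comp_continuousOn (husm.continuousOn_time x)))

/-- **Continuity of the local cubic norm `s ↦ ∫_{B(x₀, ρ)} ‖u(s)‖³`** on `[a, b]` for `u` jointly
smooth and bounded on `[a, b] × ℝ³` (dominated convergence with a constant bound on the ball). -/
theorem continuousOn_setIntegral_norm_pow_three {a b : ℝ}
    {u : ℝ → EuclideanSpace ℝ (Fin 3) → EuclideanSpace ℝ (Fin 3)} {Mu : ℝ}
    (husm : IsSmoothSpaceTimeOn (Icc a b) u) (hub : ∀ t ∈ Icc a b, ∀ x, ‖u t x‖ ≤ Mu)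
    (x₀ : EuclideanSpace ℝ (Fin 3)) (ρ : ℝ) :
    ContinuousOn (fun s => ∫ x in Metric.ball x₀ ρ, ‖u s x‖ ^ 3) (Icc a b) := by
  have huc : ∀ s ∈ Icc a b, Continuous (u s) := fun s hs => husm.continuous_slice hs
  have hconst : IntegrableOn (fun _ : EuclideanSpace ℝ (Fin 3) => Mu ^ 3) (Metric.ball x₀ ρ)
      (volume : Measure (EuclideanSpace ℝ (Fin 3))) :=
    integrableOn_const (measure_ball_lt_top (x := x₀) (r := ρ)).ne
  refine continuousOn_of_dominated (bound := fun _ => Mu ^ 3)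
    (fun s hs => ((huc s hs).norm.pow 3).aestronglyMeasurable)
    (fun s hs => Eventually.of_forall fun x => ?_) hconst (Eventually.of_forall fun x => ?_)
  · rw [norm_pow, norm_norm]
    exact pow_le_pow_left₀ (norm_nonneg _) (hub s hs x) 3
  · exact ((husm.continuousOn_time x).norm).pow 3

/-! ### The production of the cut-off mass, bounded below -/

/-- **Lower bound for the production `∫ θ (Δψ + Dψ[v])`.** For `θ ≥ 0` and a weight with
`|Δψ| ≤ C₂/R²`, `‖Dψ‖ ≤ C₁/R`, `Dψ = 0` off `B(x₀, 2R)`, and Young constants `3k²k' = 1`: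
`∫ θ (Δψ + Dψ[v]) ≥ −(C₂/R²) ∫ θ − (C₁/R) (k³ (∫ θ + ∫ θ²) + k'³ ∫_{B(x₀,2R)} ‖v‖³)`. -/
theorem production_lower_bound {θ₁ ψ : EuclideanSpace ℝ (Fin 3) → ℝ}
    {v : EuclideanSpace ℝ (Fin 3) → EuclideanSpace ℝ (Fin 3)} {x₀ : EuclideanSpace ℝ (Fin 3)}
    {R C₁ C₂ k k' : ℝ}
    (hI : Integrable (fun x => θ₁ x * ((Δ ψ) x + fderiv ℝ ψ x (v x))))
    (hIθ : Integrable θ₁) (hIθ2 : Integrable (fun x => θ₁ x ^ 2))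
    (hIv3 : IntegrableOn (fun x => ‖v x‖ ^ 3) (Metric.ball x₀ (2 * R)))
    (hpos : ∀ x, 0 ≤ θ₁ x) (hDψzero : ∀ x, 2 * R ≤ dist x x₀ → fderiv ℝ ψ x = 0)
    (hDψ : ∀ x, ‖fderiv ℝ ψ x‖ ≤ C₁ / R) (hΔψ : ∀ x, |(Δ ψ) x| ≤ C₂ / R ^ 2)
    (hR : 0 < R) (hC₁ : 0 ≤ C₁) (hk : 0 ≤ k) (hk' : 0 ≤ k') (hkk : 3 * k ^ 2 * k' = 1) :
    -(C₂ / R ^ 2 * ∫ x, θ₁ x) - C₁ / R * (k ^ 3 * ((∫ x, θ₁ x) + ∫ x, θ₁ x ^ 2) +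
        k' ^ 3 * ∫ x in Metric.ball x₀ (2 * R), ‖v x‖ ^ 3) ≤
      ∫ x, θ₁ x * ((Δ ψ) x + fderiv ℝ ψ x (v x)) := by
  set ind : EuclideanSpace ℝ (Fin 3) → ℝ :=
    (Metric.ball x₀ (2 * R)).indicator fun x => ‖v x‖ ^ 3 with hind
  have hIind : Integrable ind := hIv3.integrable_indicator measurableSet_ball
  have hCR : 0 ≤ C₁ / R := div_nonneg hC₁ hR.le
  -- the integrable minorant
  set low : (EuclideanSpace ℝ (Fin 3)) → ℝ := fun x =>
    -(C₂ / R ^ 2) * θ₁ x - C₁ / R * (k ^ 3 * (θ₁ x + θ₁ x ^ 2) + k' ^ 3 * ind x) with hlow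
  have hI0 : Integrable (fun x => θ₁ x + θ₁ x ^ 2) := hIθ.add hIθ2
  have hI1 : Integrable (fun x => k ^ 3 * (θ₁ x + θ₁ x ^ 2) + k' ^ 3 * ind x) :=
    (hI0.const_mul _).add (hIind.const_mul _)
  have hIlow : Integrable low := (hIθ.const_mul _).sub (hI1.const_mul _)
  have hval : ∫ x, low x = -(C₂ / R ^ 2 * ∫ x, θ₁ x) - C₁ / R *
      (k ^ 3 * ((∫ x, θ₁ x) + ∫ x, θ₁ x ^ 2) +
        k' ^ 3 * ∫ x in Metric.ball x₀ (2 * R), ‖v x‖ ^ 3) := by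
    rw [hlow, integral_sub (hIθ.const_mul _) (hI1.const_mul _), integral_const_mul,
      integral_const_mul, integral_add (hI0.const_mul _) (hIind.const_mul _),
      integral_const_mul, integral_const_mul, integral_add hIθ hIθ2, hind,
      integral_indicator measurableSet_ball]
    ring
  rw [← hval]
  refine integral_mono hIlow hI fun x => ?_
  -- pointwise comparison
  have hθ := hpos x
  have hΔ : -(C₂ / R ^ 2) * θ₁ x ≤ θ₁ x * (Δ ψ) x := by
    have h1 : -(C₂ / R ^ 2) ≤ (Δ ψ) x := (neg_le_neg (hΔψ x)).trans (neg_abs_le _)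
    nlinarith
  have hsum : 0 ≤ k ^ 3 * (θ₁ x + θ₁ x ^ 2) := by positivity
  show low x ≤ θ₁ x * ((Δ ψ) x + fderiv ℝ ψ x (v x))
  simp only [hlow]
  by_cases hx : 2 * R ≤ dist x x₀
  · -- outside the ball the transport term vanishes
    have hind0 : 0 ≤ k' ^ 3 * ind x := by
      rw [hind]; exact mul_nonneg (pow_nonneg hk' 3) (indicator_nonneg (fun _ _ => by positivity) x)
    rw [hDψzero x hx, zero_apply, add_zero]
    nlinarith [mul_nonneg hCR (add_nonneg hsum hind0)]
  · -- inside: `|Dψ[v]| ≤ (C₁/R) ‖v‖` and Young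
    have hxB : x ∈ Metric.ball x₀ (2 * R) := by rw [mem_ball]; linarith [not_le.1 hx]
    have hix : ind x = ‖v x‖ ^ 3 := by rw [hind, indicator_of_mem hxB]
    have hD : -(C₁ / R * ‖v x‖) ≤ fderiv ℝ ψ x (v x) := by
      have h1 : ‖fderiv ℝ ψ x (v x)‖ ≤ C₁ / R * ‖v x‖ :=
        (ContinuousLinearMap.le_opNorm _ _).trans
          (mul_le_mul_of_nonneg_right (hDψ x) (norm_nonneg _))
      rw [Real.norm_eq_abs] at h1
      exact (neg_le_neg h1).trans (neg_abs_le _)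
    have hY := mul_le_young3 hθ (norm_nonneg (v x)) hk hk' hkk
    rw [hix]
    nlinarith [mul_le_mul_of_nonneg_left hY hCR, mul_le_mul_of_nonneg_left hD hθ]

/-- **Upper bound for the cut-off mass.** For a weight `0 ≤ ψ ≤ 1` vanishing off `B(x₀, ρ)` and
`L > 0`: `∫ θ ψ ≤ (L/2) ∫ θ² + ρ³ |B₁| / (2L)` (Young and `ψ² ≤ 𝟙_{B(x₀, ρ)}`). -/
theorem integral_mul_cutoff_le {θ₁ ψ : EuclideanSpace ℝ (Fin 3) → ℝ} {x₀ : EuclideanSpace ℝ (Fin 3)}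
    {ρ L : ℝ} (hL : 0 < L) (hρ : 0 ≤ ρ)
    (hIθψ : Integrable (fun x => θ₁ x * ψ x)) (hIθ2 : Integrable (fun x => θ₁ x ^ 2))
    (hψ0 : ∀ x, 0 ≤ ψ x) (hψ1 : ∀ x, ψ x ≤ 1) (hψzero : ∀ x, ρ ≤ dist x x₀ → ψ x = 0) :
    ∫ x, θ₁ x * ψ x ≤
      L / 2 * (∫ x, θ₁ x ^ 2) + 1 / (2 * L) * (ρ ^ 3 *
        (volume : Measure (EuclideanSpace ℝ (Fin 3))).real
          (Metric.ball (0 : EuclideanSpace ℝ (Fin 3)) 1)) := by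
  set B : Set (EuclideanSpace ℝ (Fin 3)) := Metric.ball x₀ ρ with hB
  have hind : ∀ x, ψ x ^ 2 ≤ B.indicator (fun _ => (1 : ℝ)) x := by
    intro x
    by_cases hx : x ∈ B
    · rw [indicator_of_mem hx]
      have := hψ0 x
      have := hψ1 x
      nlinarith
    · rw [indicator_of_notMem hx]
      have hz : ψ x = 0 := hψzero x (by rw [hB, mem_ball] at hx; linarith [not_lt.1 hx])
      rw [hz]; norm_num
  have hIind : Integrable (B.indicator fun _ => (1 : ℝ))
      (volume : Measure (EuclideanSpace ℝ (Fin 3))) :=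
    (integrableOn_const (measure_ball_lt_top (x := x₀) (r := ρ)).ne).integrable_indicator
      measurableSet_ball
  have hvol : ∫ x, B.indicator (fun _ => (1 : ℝ)) x = ρ ^ 3 *
      (volume : Measure (EuclideanSpace ℝ (Fin 3))).real
        (ball (0 : EuclideanSpace ℝ (Fin 3)) 1) := by
    rw [integral_indicator_const _ measurableSet_ball, smul_eq_mul, mul_one,
      ← Measure.addHaar_real_closedBall_eq_addHaar_real_ball,
      Measure.addHaar_real_closedBall _ _ hρ, finrank_euclideanSpace_fin]
  calc ∫ x, θ₁ x * ψ x
      ≤ ∫ x, (L / 2 * θ₁ x ^ 2 + (1 / (2 * L)) * B.indicator (fun _ => (1 : ℝ)) x) := by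
        refine integral_mono hIθψ ((hIθ2.const_mul _).add (hIind.const_mul _)) fun x => ?_
        have hY := mul_le_young2 (θ₁ x) (ψ x) hL
        have h2 : 1 / (2 * L) * ψ x ^ 2 ≤ 1 / (2 * L) * B.indicator (fun _ => (1 : ℝ)) x :=
          mul_le_mul_of_nonneg_left (hind x) (by positivity)
        exact hY.trans (by linarith)
    _ = L / 2 * (∫ x, θ₁ x ^ 2) + 1 / (2 * L) * (ρ ^ 3 *
        (volume : Measure (EuclideanSpace ℝ (Fin 3))).real
          (ball (0 : EuclideanSpace ℝ (Fin 3)) 1)) := by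
        rw [integral_add (hIθ2.const_mul _) (hIind.const_mul _), integral_const_mul,
          integral_const_mul, hvol]

/-- **Mass of a bump from below**: `rIn³ |B₁| ≤ ∫ φ` (`φ = 1` on `B̄(c, rIn)`, `φ ≥ 0`). -/
theorem bump_integral_ge {c : EuclideanSpace ℝ (Fin 3)} (φ : ContDiffBump c) :
    φ.rIn ^ 3 * (volume : Measure (EuclideanSpace ℝ (Fin 3))).real
      (Metric.ball (0 : EuclideanSpace ℝ (Fin 3)) 1) ≤ ∫ x, φ x := by
  have hind : ∀ x, (closedBall c φ.rIn).indicator (fun _ => (1 : ℝ)) x ≤ φ x := by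
    intro x
    by_cases hx : x ∈ closedBall c φ.rIn
    · rw [indicator_of_mem hx, φ.one_of_mem_closedBall hx]
    · rw [indicator_of_notMem hx]; exact φ.nonneg
  calc φ.rIn ^ 3 *
        (volume : Measure (EuclideanSpace ℝ (Fin 3))).real (ball (0 : EuclideanSpace ℝ (Fin 3)) 1)
      = (volume : Measure (EuclideanSpace ℝ (Fin 3))).real (closedBall c φ.rIn) := by
        rw [Measure.addHaar_real_closedBall _ _ φ.rIn_pos.le, finrank_euclideanSpace_fin]
    _ = ∫ x, (closedBall c φ.rIn).indicator (fun _ => (1 : ℝ)) x := by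
        rw [integral_indicator_const _ measurableSet_closedBall, smul_eq_mul, mul_one]
    _ ≤ ∫ x, φ x :=
        integral_mono_of_nonneg (ae_of_all _ fun x => indicator_nonneg (fun _ _ => zero_le_one) x)
          φ.integrable (ae_of_all _ hind)

/-- **`L²` mass of a bump is at most its mass**: `∫ φ² ≤ ∫ φ` (`0 ≤ φ ≤ 1`), and `φ²` is
integrable. -/
theorem bump_integral_sq_le {c : EuclideanSpace ℝ (Fin 3)} (φ : ContDiffBump c) :
    Integrable (fun x => φ x ^ 2) (volume : Measure (EuclideanSpace ℝ (Fin 3))) ∧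
      ∫ x, φ x ^ 2 ≤ ∫ x, φ x := by
  have hle : ∀ x, φ x ^ 2 ≤ φ x := fun x => by
    have := φ.nonneg (x := x)
    have := φ.le_one (x := x)
    nlinarith
  have hI : Integrable (fun x => φ x ^ 2) (volume : Measure (EuclideanSpace ℝ (Fin 3))) :=
    φ.integrable.mono' ((φ.continuous.pow 2).aestronglyMeasurable)
      (ae_of_all _ fun x => by
        rw [Real.norm_eq_abs, abs_of_nonneg (sq_nonneg _)]
        exact hle x)
  exact ⟨hI, integral_mono hI φ.integrable hle⟩

/-- **The cut-off does not see the bump**: if `ψ = 1` on `B̄(c, R)` with `φ.rOut ≤ R`, then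
`φ ψ = φ` pointwise, so `∫ φ ψ = ∫ φ`. -/
theorem bump_mul_cutoff_integral {c : EuclideanSpace ℝ (Fin 3)} (φ : ContDiffBump c)
    {ψ : EuclideanSpace ℝ (Fin 3) → ℝ} {R : ℝ}
    (hR : φ.rOut ≤ R) (hψone : ∀ x, dist x c ≤ R → ψ x = 1) :
    ∫ x, φ x * ψ x = ∫ x, φ x := by
  refine integral_congr_ae (ae_of_all _ fun x => ?_)
  by_cases hx : dist x c ≤ R
  · simp [hψone x hx]
  · have hx' : x ∉ Function.support (φ : (EuclideanSpace ℝ (Fin 3)) → ℝ) := by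
      rw [φ.support_eq, mem_ball]
      linarith [not_le.1 hx]
    have : φ x = 0 := by simpa [Function.mem_support] using hx'
    simp [this]

end LoadFloor

/-! ### Anchor: the registered tools sub-goal -/

/-- **Tools sub-goal `lfaux_loadOfCknC` (worker, stub LF): the scaled load controls the local
space–time `L³` integral of the drift.** If `u` is continuous on `[0, T) × ℝ³`, `0 < ρ`,
`0 ≤ T − ρ²`, `T − ρ² < t₀ ≤ t₁ < T` and `C(ρ) = ρ⁻² ∬_{Q_ρ(T, x₀)} |u|³ ≤ M` (`cknC`), then
`∫_{(t₀, t₁]} ∫_{B(x₀, ρ)} ‖u‖³ ≤ ρ² M` (the set-integral form of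
`LoadFloor.intervalIntegral_setIntegral_norm_pow_three_le`). -/
theorem lfaux_loadOfCknC :
    ∀ (T ρ M t₀ t₁ : ℝ) (u : ℝ → EuclideanSpace ℝ (Fin 3) → EuclideanSpace ℝ (Fin 3))
      (x₀ : EuclideanSpace ℝ (Fin 3)), 0 < ρ → 0 ≤ M →
      ContinuousOn (Function.uncurry u) (Set.Ico 0 T ×ˢ Set.univ) → 0 ≤ T - ρ ^ 2 →
      T - ρ ^ 2 < t₀ → t₀ ≤ t₁ → t₁ < T →
      Literature.Analysis.FluidPDE.cknC ρ ((T, x₀) : ℝ × EuclideanSpace ℝ (Fin 3)) u ≤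
        ENNReal.ofReal M →
      ∫ s in Set.Ioc t₀ t₁, ∫ x in Metric.ball x₀ ρ, ‖u s x‖ ^ 3 ≤ ρ ^ 2 * M := by
  intro T ρ M t₀ t₁ u x₀ hρ hM hcont h0 ht₀ ht₀₁ ht₁ hC
  have h := LoadFloor.intervalIntegral_setIntegral_norm_pow_three_le hρ hM hcont h0 ht₀ ht₀₁
    ht₁ hC
  rwa [intervalIntegral.integral_of_le ht₀₁] at h

end Summit.NavierStokesRegularity.NavierStokesRegularity.Theorems

end
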